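import Summits.NavierStokesRegularity.FluidComputer.BlockOpenWindow

/-!
# Fourier-block instance — §11 OPEN WINDOWS (2/2): between half-open windows the CIRCUIT+CLOCK half
# is inhabited CONSERVATIVELY (no regulation); the `Params.reg` instance and its closed-form residue

HONEST FRAMING. Low prior, high value-of-information experiment on Tao's machine paradigm; NOT a
claim that NS blows up. Nothing in this file is evidence about Navier–Stokes: it prices planar
gates between the half-open windows of `BlockOpenWindow` and exhibits one (a design-level object).

1. NECESSITY survives: an `ε`-passive open-window circuit (`PassiveO`, inhabiting `DatO`) still
   needs `η (aLo + δsh)² ≤ (aLo − δ)² + ε` (`eta_le_of_passiveO`; so `Params.std`'s fat core is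
   still dead at `η ≥ 1/2`: `std_eta_leO`), but `withholding_law` / `conservative_needs_spent` of
   `BlockRegulation` have NO analogue, because:
2. SUFFICIENCY, CONSERVATIVELY: the energy-CONSERVING quarter turn `regGate η 0` (complete transfer
   at `σ = 1`, no bleed, firing instant independent of the amplitude) inhabits the open `dat` for
   every parameter set with `(aLo + δsh) √η ≤ aLo − δ` and `√η (c0 + δ) + δsh ≤ σsp`
   (`conservative_datO`) — for `Params.reg` and `δsh = 1/50`: every `η ≤ 9/10`
   (`openRegCircuitClock`, `τc = 1`, `unit n = Tmax n`). So the passive bound is SHARP and is the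
   ONLY energy constraint: the "regulation" of §9–§10 was an artefact of the bounded window, not of
   fixed windows as such. In floor units the conserved transfer RAISES the amplitude by the factor
   `1/√η > 1` per generation (`E_{n+1} = E_n` while the floor drops to `η E_n`); the half-open
   window absorbs this drift together with the hand-off thickening `δ`, which is what Tao's energy
   bookkeeping does (thresholds relative to the energy present, lower bounds only).
3. `ns_blowup_of_openRegIdeaBound`: for `Params.reg`, `η ∈ [1/2, 9/10]` (`alphaEff ≥ 2`), `α > 0`,
   the residue of the lane is the single `Prop` `OpenIdeaBound 𝒟 Params.reg openRegCircuitClock`: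
   true NS, started from `a √E_n ψ_n + (junk ≤ ½ √E_n)` with ANY `a > aLo − δ`, follows the
   amplitude-independent quarter rotation of its two block amplitudes within `T_n` up to `1/50`, and
   keeps its weighted junk below `√E_n` meanwhile. IDEA-BOUND and, for the bare two-wavelet design,
   PRESUMABLY FALSE (no mechanism makes two Fourier shells do this); recorded as a closed formula,
   NOT claimed. Liveness of this design GIVEN the residue: `BlockOpenLive`.
-/

noncomputable section

open MeasureTheory Set Filter Topology Metric
open scoped ENNReal NNReal SchwartzMap

namespace Summit.NavierStokesRegularity.FluidComputer

open Literature.Analysis.FluidPDE Literature.Analysis.FluidPDE.Tao2016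
open Literature.Analysis.FluidPDE.FluidComputer
open Summit.NavierStokesRegularity.NavierStokesRegularity.Theorems.FluidComputer

namespace BlockDesign

/-! ## Necessity survives: the passive bound for open windows -/

section PassiveBound

variable {S : CascadeSpecs} (P : Params S)

/-- Open firing bounds: if the closed `δsh`-ball about `q = (x, y)` lies in `AoutO`, then
`|x| + δsh ≤ σsp` and `aLo + δsh ≤ y`. [folklore] -/
theorem fire_boundsO {q : ℝ × ℝ} {δsh : ℝ} (hδ : 0 ≤ δsh)
    (h : Metric.closedBall q δsh ⊆ AoutO P) : |q.1| + δsh ≤ P.σsp ∧ P.aLo + δsh ≤ q.2 := by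
  have mem : ∀ x y : ℝ, |x - q.1| ≤ δsh → |y - q.2| ≤ δsh →
      (-P.σsp ≤ x ∧ x ≤ P.σsp) ∧ P.aLo ≤ y := by
    intro x y hx hy
    have hxy : (x, y) ∈ AoutO P :=
      h (by rw [Metric.mem_closedBall, Prod.dist_eq, Real.dist_eq, Real.dist_eq]; exact max_le hx hy)
    simpa only [AoutO, Set.mem_prod, Set.mem_Icc, Set.mem_Ici] using hxy
  have e1 : |q.1 + δsh - q.1| ≤ δsh := by
    rw [show q.1 + δsh - q.1 = δsh by ring, abs_of_nonneg hδ]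
  have e2 : |q.1 - δsh - q.1| ≤ δsh := by
    rw [show q.1 - δsh - q.1 = -δsh by ring, abs_neg, abs_of_nonneg hδ]
  have e4 : |q.2 - δsh - q.2| ≤ δsh := by
    rw [show q.2 - δsh - q.2 = -δsh by ring, abs_neg, abs_of_nonneg hδ]
  have e0x : |q.1 - q.1| ≤ δsh := by rw [sub_self, abs_zero]; exact hδ
  have e0y : |q.2 - q.2| ≤ δsh := by rw [sub_self, abs_zero]; exact hδ
  refine ⟨?_, ?_⟩
  · rcases le_or_gt 0 q.1 with hq | hq
    · have := (mem _ _ e1 e0y).1.2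
      rw [abs_of_nonneg hq]; linarith
    · have := (mem _ _ e2 e0y).1.1
      rw [abs_of_neg hq]; linarith
  · have := (mem _ _ e0x e4).2
    linarith

/-- Pointwise open passive bound: firing from `(a, 0)` with `aLo − δ < a` needs
`η (aLo + δsh)² ≤ a² + ε`. [folklore] -/
theorem eta_sq_le_of_passiveO {Φ : ℝ → ℝ × ℝ → ℝ × ℝ} {τc δsh ε : ℝ} (hδsh : 0 ≤ δsh)
    (hP : PassiveO P Φ τc ε) (hD : DatO P Φ τc δsh) {a : ℝ} (h1 : P.aLo - P.δ < a) :
    S.eta * (P.aLo + δsh) ^ 2 ≤ a ^ 2 + ε := by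
  obtain ⟨σ, hσ0, hσ1, hball⟩ := hD (a, 0) (mem_AinO_base h1)
  obtain ⟨-, hy⟩ := fire_boundsO P hδsh hball
  have hpass : (Φ σ (a, 0)).1 ^ 2 + S.eta * (Φ σ (a, 0)).2 ^ 2 ≤ a ^ 2 + S.eta * 0 ^ 2 + ε :=
    hP (a, 0) (mem_AinO_base h1) σ hσ0 hσ1
  have hy0 : 0 ≤ P.aLo + δsh := by linarith [P.one_le_aLo]
  have h3 : (P.aLo + δsh) ^ 2 ≤ (Φ σ (a, 0)).2 ^ 2 := pow_le_pow_left₀ hy0 hy 2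
  have h4 := mul_le_mul_of_nonneg_left h3 S.eta_pos.le
  nlinarith [sq_nonneg (Φ σ (a, 0)).1]

/-- **Open passive bound.** `η (aLo + δsh)² ≤ (aLo − δ)² + ε` for every `ε`-passive gate
inhabiting the open `dat` — the same necessary condition as for bounded windows
(`BlockRegulation.eta_le_of_passive`). [folklore] -/
theorem eta_le_of_passiveO {Φ : ℝ → ℝ × ℝ → ℝ × ℝ} {τc δsh ε : ℝ} (hδsh : 0 ≤ δsh)
    (hP : PassiveO P Φ τc ε) (hD : DatO P Φ τc δsh) :
    S.eta * (P.aLo + δsh) ^ 2 ≤ (P.aLo - P.δ) ^ 2 + ε := by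
  have key := le_sq_of_forall_pos (C := S.eta * (P.aLo + δsh) ^ 2 - ε) (d := P.aLo - P.δ)
    (by linarith [P.one_le]) P.δ_pos (fun e he _ => by
      have := eta_sq_le_of_passiveO P hδsh hP hD (a := P.aLo - P.δ + e) (by linarith)
      linarith)
  linarith

/-- In particular `Params.std` (fat core `δ = 1/2`) admits no `0`-passive open-window circuit at any
viscosity-admissible efficiency either: `η ≤ 4/9 · (1 + ε)`. [folklore] -/
theorem std_eta_leO (hS : S.lam0 = 1) (hη : 1 / 4 < S.eta) {Φ : ℝ → ℝ × ℝ → ℝ × ℝ}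
    {τc δsh ε : ℝ} (hδsh : 0 ≤ δsh) (hP : PassiveO (Params.std S hS hη) Φ τc ε)
    (hD : DatO (Params.std S hS hη) Φ τc δsh) : S.eta ≤ 4 / 9 * (1 + ε) := by
  have h : S.eta * (3 / 2 + δsh) ^ 2 ≤ (3 / 2 - 1 / 2) ^ 2 + ε :=
    eta_le_of_passiveO (Params.std S hS hη) hδsh hP hD
  have h9 : (9 / 4 : ℝ) ≤ (3 / 2 + δsh) ^ 2 := by nlinarith
  nlinarith [S.eta_pos]

end PassiveBound

/-! ## Sufficiency, conservatively: the quarter turn inhabits the open `dat` -/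

section Conservative

variable {S : CascadeSpecs} (P : Params S)

/-- At `σ = 1` the conservative gate is the complete transfer `(a, b) ↦ (−√η b, a/√η)`. [folklore] -/
theorem regGate_zero_one (η : ℝ) (p : ℝ × ℝ) :
    regGate η 0 1 p = (-(Real.sqrt η * p.2), p.1 / Real.sqrt η) := by
  simp only [regGate, lt_irrefl, if_false, zero_mul, sub_zero, Real.sqrt_one, mul_one]

/-- The conservative gate is `0`-passive on the open input region (indeed energy-conserving on
`[0, 1]`). [folklore] -/
theorem regGate_passiveO (τc : ℝ) : PassiveO P (regGate S.eta 0) τc 0 := by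
  intro p _ σ _ _
  rcases lt_or_ge σ 1 with hσ | hσ
  · rw [pairEnergy_regGate_of_lt_one S.eta_pos 0 hσ p, add_zero]
  · rw [pairEnergy_regGate_of_one_le S.eta_pos zero_le_one hσ p, add_zero, zero_mul, sub_zero,
      one_mul]

/-- The conservative gate CONSERVES the two-block energy at every rescaled time (its bleed phase
bleeds nothing). [folklore] -/
theorem pairEnergy_regGate_zero (σ : ℝ) (p : ℝ × ℝ) :
    pairEnergy S.eta (regGate S.eta 0 σ p) = pairEnergy S.eta p := by
  rcases lt_or_ge σ 1 with h | h
  · exact pairEnergy_regGate_of_lt_one S.eta_pos 0 h p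
  · rw [pairEnergy_regGate_of_one_le S.eta_pos zero_le_one h p, zero_mul, sub_zero, one_mul]

/-- **The conservative quarter turn inhabits the open `dat`** (firing at `σ = 1` from every input,
`τc = 1`) whenever the weakest input still clears the floor after the turn,
`(aLo + δsh) √η ≤ aLo − δ`, and the emptied input block plus margin fits the spent tolerance,
`√η (c0 + δ) + δsh ≤ σsp`. No withholding, no amplitude-dependent firing. [folklore] -/
theorem conservative_datO {δsh : ℝ}
    (hlo : (P.aLo + δsh) * Real.sqrt S.eta ≤ P.aLo - P.δ)
    (hsp : Real.sqrt S.eta * (P.c0 + P.δ) + δsh ≤ P.σsp) :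
    DatO P (regGate S.eta 0) 1 δsh := by
  intro p hp
  obtain ⟨ha, hb⟩ := AinO_bounds hp
  have hη := Real.sqrt_pos.2 S.eta_pos
  refine ⟨1, zero_le_one, le_rfl, ?_⟩
  intro q hq
  rw [regGate_zero_one, Metric.mem_closedBall, Prod.dist_eq, Real.dist_eq, Real.dist_eq] at hq
  have hq1 : |q.1 - -(Real.sqrt S.eta * p.2)| ≤ δsh := le_trans (le_max_left _ _) hq
  have hq2 : |q.2 - p.1 / Real.sqrt S.eta| ≤ δsh := le_trans (le_max_right _ _) hq
  have h1 := abs_le.1 hq1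
  have h2 := abs_le.1 hq2
  have hb' := abs_lt.1 hb
  -- the emptied input block: `|q.1| ≤ √η (c0 + δ) + δsh ≤ σsp`
  have hx : |Real.sqrt S.eta * p.2| ≤ Real.sqrt S.eta * (P.c0 + P.δ) := by
    rw [abs_mul, abs_of_pos hη]
    exact mul_le_mul_of_nonneg_left hb.le hη.le
  have hx' := abs_le.1 hx
  -- the loaded output block: `q.2 ≥ a/√η − δsh > aLo`
  have hy : P.aLo + δsh < p.1 / Real.sqrt S.eta := by
    rw [lt_div_iff₀ hη]
    exact lt_of_le_of_lt hlo ha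
  simp only [AoutO, Set.mem_prod, Set.mem_Icc, Set.mem_Ici]
  exact ⟨⟨by linarith, by linarith⟩, by linarith⟩

end Conservative

/-! ## `Params.reg` with open windows: the conservative circuit+clock and the closed-form residue -/

section Reg

variable (S : CascadeSpecs)

/-- For `Params.reg` (`aLo = 3/2`, `δ = 1/20`, `c0 = 3/20`, `σsp = 1/4`) and `δsh = 1/50` the two
hypotheses of `conservative_datO` hold for every `η ≤ 9/10`:
`1.52 √η ≤ 1.45` (`η ≤ 0.91003…`) and `0.2 √η + 0.02 ≤ 0.25`. [folklore] -/
theorem reg_conservative_datO (hS : S.lam0 = 1) (hη : 1 / 2 ≤ S.eta) (hη2 : S.eta ≤ 9 / 10) :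
    DatO (Params.reg S hS hη) (regGate S.eta 0) 1 (1 / 50) := by
  have hs1 : Real.sqrt S.eta ≤ 19 / 20 := by
    rw [Real.sqrt_le_left (by norm_num)]
    linarith
  have hs0 : 0 ≤ Real.sqrt S.eta := Real.sqrt_nonneg _
  refine conservative_datO (Params.reg S hS hη) ?_ ?_
  · show ((3 : ℝ) / 2 + 1 / 50) * Real.sqrt S.eta ≤ 3 / 2 - 1 / 20
    nlinarith
  · show Real.sqrt S.eta * (3 / 20 + 1 / 20) + 1 / 50 ≤ (1 : ℝ) / 4
    nlinarith

/-- **The open CIRCUIT+CLOCK half inhabited CONSERVATIVELY** for `Params.reg`, every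
`η ∈ [1/2, 9/10]`: the quarter turn `regGate η 0`, `τc = 1`, `δsh = 1/50`, clock `unit n = Tmax n`.
[folklore] -/
def openRegCircuitClock (hS : S.lam0 = 1) (hη : 1 / 2 ≤ S.eta) (hη2 : S.eta ≤ 9 / 10) :
    OpenCircuitClock (Params.reg S hS hη) where
  Φ := regGate S.eta 0
  τc := 1
  τc_nonneg := zero_le_one
  δsh := 1 / 50
  δsh_nonneg := by norm_num
  dat := reg_conservative_datO S hS hη hη2
  unit n := S.Tmax n
  unit_pos n := S.Tmax_pos n
  clock n := (mul_one _).le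

/-- The open regulation-free circuit conserves the two-block energy at all rescaled times and is
`0`-passive. [folklore] -/
theorem openRegCircuitClock_conservative (hS : S.lam0 = 1) (hη : 1 / 2 ≤ S.eta)
    (hη2 : S.eta ≤ 9 / 10) :
    (∀ p : ℝ × ℝ, ∀ σ : ℝ,
        pairEnergy S.eta ((openRegCircuitClock S hS hη hη2).Φ σ p) = pairEnergy S.eta p) ∧
      PassiveO (Params.reg S hS hη) (openRegCircuitClock S hS hη hη2).Φ
        (openRegCircuitClock S hS hη hη2).τc 0 :=
  ⟨fun p σ => pairEnergy_regGate_zero σ p, regGate_passiveO _ _⟩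

/-- At these efficiencies the spec is viscosity-admissible: `2 ≤ alphaEff`. [folklore] -/
theorem two_le_alphaEff_of_half_le (hη : 1 / 2 ≤ S.eta) : 2 ≤ S.alphaEff :=
  S.two_le_alphaEff_iff.2 hη

variable {S}

/-- **The residue as a closed formula, open windows.** For `Params.reg` with half-open windows at
`η ∈ [1/2, 9/10]`, `α > 0`: the two IDEA-BOUND claims about Navier–Stokes relative to the explicit
CONSERVATIVE quarter-turn circuit refute Clay (A). HONEST FRAMING: an implication from a `Prop` this
lane presumes FALSE for the two-wavelet design; NOT a claim that NS blows up; recorded so that the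
residue has no free design parameter and no regulation demand left. -/
theorem ns_blowup_of_openRegIdeaBound {𝒟 : CascadeWaveletData 1 1} (hS : S.lam0 = 1)
    (hη : 1 / 2 ≤ S.eta) (hη2 : S.eta ≤ 9 / 10) (hα : 0 < S.alpha)
    (H : OpenIdeaBound 𝒟 (Params.reg S hS hη) (openRegCircuitClock S hS hη hη2)) :
    ¬ NavierStokesRegularity :=
  ns_blowup_of_openIdeaBound _ H hα (by linarith)

/-- The hypotheses other than `OpenIdeaBound` are jointly satisfiable: a wavelet datum exists and
`λ₀ = 1`, `α = 1`, `η = 1/2` is an admissible spec. [folklore] -/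
theorem openReg_hypotheses_inhabited :
    ∃ (_ : CascadeWaveletData 1 1) (S : CascadeSpecs),
      S.lam0 = 1 ∧ 0 < S.alpha ∧ 1 / 2 ≤ S.eta ∧ S.eta ≤ 9 / 10 := by
  obtain ⟨𝒟⟩ := nonempty_design
  exact ⟨𝒟, ⟨1, 1, 1, 1, 1 / 2, one_pos, one_pos, one_pos, by norm_num, by norm_num⟩, rfl, one_pos,
    by norm_num, by norm_num⟩

end Reg

end BlockDesign

end Summit.NavierStokesRegularity.FluidComputer

end
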